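import Mathlib
import HarnessLib
import Summits.HubbardSuperconductivity.HubbardSuperconductivity.Theorems.KLProgrammeKLRegimeCountertermReadingRegime
import Summits.HubbardSuperconductivity.HubbardSuperconductivity.Theorems.KLProgrammeKLRegimeCountertermPicardReading
import Summits.HubbardSuperconductivity.HubbardSuperconductivity.Theorems.KLProgrammeKLRegimeCountertermV11Volume

/-!
# Route `KLProgramme` — the Counterterm child of crux K3 (gen-3 item stmt-HubbardSuperconductivity-19825 `KLRegimeCountertermV11`
# `:= CountertermP2 klPredsV11 klWindowC`): THE GATE INDUCTION — renormalisation of an admissible frame at EVERY scale from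
# CONDITIONAL sup bounds of its partial sums `K ⊕ Σ_{i ≤ j} ℓ_i^G(K)` (seat hubbard-kl-k3c3-p1, part H; the «reading» half of
# `CtOneVolumeMsV11`, plan g10 2026-08-26 20:18Z (B) `stub_ct_reading`)

The hypothesis block `CtHypMsV11` delivers the slots at scale `j` for a frame only if the frame is renormalised BELOW `j`; the sup bound of the
`j`-th partial sum of a Picard image (part F `abs_eval_counterImage_add_partialSum_le` + part G `abs_piece_response_le`) needs (E3c-G) at the
scales `i ≤ j`, i.e. again renormalisation below `j`; and renormalisation AT `j` is read off that sup bound (part E).  This module runs the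
circle ONCE, by strong induction on the scale, for every admissible frame at one volume:

**`abs_klLocalPart_le_all_of_partialSums`.**  For `(G, P, Q)` well formed there are VOLUME/β/U/FRAME-FREE `c₃, U₀ > 0`, `Λ_K ≥ 0`, `r₀ > 0`
such that in the regime (`0 < c ≤ c₃`, `0 < U ≤ U₀`, `klBetaMin ≤ β ≤ e^{c/U²}`, `μ ∈ klWindowC`), for every hypothesis block
`CtHypMsV11 G P Q β U μ Lh Mh`, every admissible frame `K` (`FrameOK (ctRenMs G) U (nScales β) μ K`), every volume `(L, M)` beyond `(Lh, Mh L)`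
with `L ≥ max(20, 8π/klFlatR)`, `2π/L < r₀`, every family of sup bounds `B j` that hold CONDITIONALLY on renormalisation below `j`
(`(∀ i < j, RenormalisedAtF … K (ctRenMs G) i) → ∀ q, |K(q) + Σ_{i ≤ j} ℓ_i^G(K)(q)| ≤ B j`) and every target `T j ≤ tol_j := ctCr G·|U|·Λ_j²/e₀`
with `B j + wig(L) ≤ T j`, `wig(L) := (4/3)(G.S 1 + Q.S′ 1·|U|)U²·(2π/L) + (angBar G Q (ctRenMs G) U (nScales β) 1 + Λ_K)·π·(2π/L)/r₀`:
`|ν_j(K)(θ)| ≤ T j` for every `j ≤ nScales β` and every `θ`.  Corollaries: `renormalisedAtF_all_of_partialSums` (`T = tol`) and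
`abs_klLocalPart_le_half_all_of_partialSums` (`T = tol/2`, the clause of `CtOneVolumeMsV11`).

Proofs only; nothing is asserted about the Hubbard model.
-/

noncomputable section

namespace Summit.HubbardSuperconductivity.HubbardSuperconductivity.Theorems.KLRegimeSplit

set_option linter.dupNamespace false -- summit = problem name (single-conjunct summit), D-0017

open Real Finset
open Literature.MathematicalPhysics.QuantumLattice Literature.Probability.LatticeModels
open Summit.HubbardSuperconductivity.HubbardSuperconductivity.Theorems.KLProgrammeLegKernels

/-- The renormalisation package of the V11 counterterm child has nonnegative frame radii. -/
theorem ctRenMs_Gfr_nonneg {G : GeoConsts} (hG : G.WF) (j : ℕ) : 0 ≤ (ctRenMs G).Gfr j := by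
  have hS : ∀ j, 0 ≤ G.S j := hG.2.2.2.2.2.2.2.2.2.2.2.2.2.2.2.2.2.1
  show 0 ≤ 2 * (G.S j + 1)
  nlinarith [hS j]

/-- **THE GATE INDUCTION.**  See the module docstring. -/
theorem abs_klLocalPart_le_all_of_partialSums (G : GeoConsts) (P : SplitConsts) (Q : EngConsts) (hG : G.WF) (hQ : Q.WF) :
    ∃ c₃ : ℝ, 0 < c₃ ∧ ∃ U₀ : ℝ, 0 < U₀ ∧ ∃ ΛK : ℝ, 0 ≤ ΛK ∧ ∃ r₀ : ℝ, 0 < r₀ ∧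
      ∀ c : ℝ, 0 < c → c ≤ c₃ → ∀ U : ℝ, 0 < U → U ≤ U₀ → ∀ β : ℝ, klBetaMin ≤ β → β ≤ Real.exp (c / U ^ 2) →
      ∀ μ ∈ klWindowC, ∀ (Lh : ℕ) (Mh : ℕ → ℕ), CtHypMsV11 G P Q β U μ Lh Mh →
      ∀ K : TrigPolyC4v, FrameOK (ctRenMs G) U (nScales β) μ K →
      ∀ (L M : ℕ) [NeZero L] [NeZero M], Lh ≤ L → Mh L ≤ M → (20 : ℝ) ≤ L → 8 * π / klFlatR ≤ L → 2 * π / L < r₀ →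
      ∀ (B T : ℕ → ℝ),
        (∀ j ≤ nScales β, (∀ i < j, RenormalisedAtF L M β U μ K (ctRenMs G) i) →
          ∀ q : Fin 2 → ℝ, |K.eval q + ∑ i ∈ range (j + 1), (klTwoLegPieceG L M β U μ K i).eval q| ≤ B j) →
        (∀ j ≤ nScales β, T j ≤ ctCr G * |U| * klScale klE0 j ^ 2 / klE0) →
        (∀ j ≤ nScales β, B j + (4 / 3 * (G.S 1 + Q.S' 1 * |U|) * U ^ 2 * (2 * π / L) +
          (angBar G Q (ctRenMs G) U (nScales β) 1 + ΛK) * π * (2 * (π / L) / r₀)) ≤ T j) →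
        ∀ j ≤ nScales β, ∀ θ : ℝ, |klLocalPart L M β U μ K j θ| ≤ T j := by
  have hR : ∀ j, 0 ≤ (ctRenMs G).Gfr j := ctRenMs_Gfr_nonneg hG
  obtain ⟨c₃, hc₃, U₀, hU₀, ΛK, hΛK, r₀, hr₀, hgate⟩ := abs_klLocalPart_le_of_partialSum_frameOK (ctRenMs G) hR
  refine ⟨c₃, hc₃, U₀, hU₀, ΛK, hΛK, r₀, hr₀, ?_⟩
  intro c hc hcle U hU hUle β hβmin hβc μ hμ Lh Mh hyp K hK L M _ _ hLh hMh hL20 hLflat hLu B T hB hT htol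
  have hS1 : 0 ≤ G.S 1 + Q.S' 1 * |U| := by
    have hS : ∀ j, 0 ≤ G.S j := hG.2.2.2.2.2.2.2.2.2.2.2.2.2.2.2.2.2.1
    have hS' : ∀ j, 0 ≤ Q.S' j := hQ.2.2.2.2.1
    have := hS 1; have := hS' 1; positivity
  have hRWF : (ctRenMs G).WF := (ctRenMs_WF2 hG).1
  have hang0 : 0 ≤ angBar G Q (ctRenMs G) U (nScales β) 1 := angBar_nonneg hG hQ hRWF U (nScales β) 1
  -- strong induction on the scale
  intro j
  induction j using Nat.strong_induction_on with
  | _ j ih =>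
    intro hj θ
    -- renormalisation below `j` (induction hypothesis + `T ≤ tol`)
    have hren : ∀ i < j, RenormalisedAtF L M β U μ K (ctRenMs G) i := fun i hi θ' =>
      (ih i hi (le_of_lt (lt_of_lt_of_le hi hj)) θ').trans (hT i (le_of_lt (lt_of_lt_of_le hi hj)))
    -- the slots at the scales `≤ j`
    have hsizes : ∀ i ≤ j, TwoLegSizesG L M G Q (ctRenMs G) β U μ K i := fun i hi =>
      (hyp.twoLegStepG hK hLh hMh (hi.trans hj) fun i' hi' => hren i' (lt_of_lt_of_le hi' hi)).1
    have hang : TwoLegAngularG L M G Q (ctRenMs G) β U μ K j := hyp.twoLegAngularG hK hLh hMh hj hren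
    -- the reading at `θ`
    have hread := hgate c hc hcle U hU hUle β hβmin hβc μ hμ K hK L M hL20 hLflat hLu j
      (angBar G Q (ctRenMs G) U (nScales β) 1) hang0 (fun a b => hang.abs_sub_le a b)
      (∑ i ∈ range (j + 1), twoLegBar G Q U 1 i) (sum_nonneg fun i _ => by rw [twoLegBar_one_eq]; positivity)
      (abs_partialSum_sub_le_of_sizes L M hsizes) θ
    have hBj := hB j hj hren (klFermiPoint μ K θ)
    have hΛℓ : (∑ i ∈ range (j + 1), twoLegBar G Q U 1 i) * (2 * π / L) ≤
        4 / 3 * (G.S 1 + Q.S' 1 * |U|) * U ^ 2 * (2 * π / L) := by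
      have hLpos : (0 : ℝ) < L := by linarith
      exact mul_le_mul_of_nonneg_right (sum_twoLegBar_one_le G Q U hS1 _) (by positivity)
    have := htol j hj
    linarith

/-- **Renormalisation at every scale** from conditional sup bounds of the partial sums (`T = tol`). -/
theorem renormalisedAtF_all_of_partialSums (G : GeoConsts) (P : SplitConsts) (Q : EngConsts) (hG : G.WF) (hQ : Q.WF) :
    ∃ c₃ : ℝ, 0 < c₃ ∧ ∃ U₀ : ℝ, 0 < U₀ ∧ ∃ ΛK : ℝ, 0 ≤ ΛK ∧ ∃ r₀ : ℝ, 0 < r₀ ∧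
      ∀ c : ℝ, 0 < c → c ≤ c₃ → ∀ U : ℝ, 0 < U → U ≤ U₀ → ∀ β : ℝ, klBetaMin ≤ β → β ≤ Real.exp (c / U ^ 2) →
      ∀ μ ∈ klWindowC, ∀ (Lh : ℕ) (Mh : ℕ → ℕ), CtHypMsV11 G P Q β U μ Lh Mh →
      ∀ K : TrigPolyC4v, FrameOK (ctRenMs G) U (nScales β) μ K →
      ∀ (L M : ℕ) [NeZero L] [NeZero M], Lh ≤ L → Mh L ≤ M → (20 : ℝ) ≤ L → 8 * π / klFlatR ≤ L → 2 * π / L < r₀ →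
      ∀ B : ℕ → ℝ,
        (∀ j ≤ nScales β, (∀ i < j, RenormalisedAtF L M β U μ K (ctRenMs G) i) →
          ∀ q : Fin 2 → ℝ, |K.eval q + ∑ i ∈ range (j + 1), (klTwoLegPieceG L M β U μ K i).eval q| ≤ B j) →
        (∀ j ≤ nScales β, B j + (4 / 3 * (G.S 1 + Q.S' 1 * |U|) * U ^ 2 * (2 * π / L) +
          (angBar G Q (ctRenMs G) U (nScales β) 1 + ΛK) * π * (2 * (π / L) / r₀)) ≤ ctCr G * |U| * klScale klE0 j ^ 2 / klE0) →
        ∀ j ≤ nScales β, RenormalisedAtF L M β U μ K (ctRenMs G) j := by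
  obtain ⟨c₃, hc₃, U₀, hU₀, ΛK, hΛK, r₀, hr₀, h⟩ := abs_klLocalPart_le_all_of_partialSums G P Q hG hQ
  refine ⟨c₃, hc₃, U₀, hU₀, ΛK, hΛK, r₀, hr₀, ?_⟩
  intro c hc hcle U hU hUle β hβmin hβc μ hμ Lh Mh hyp K hK L M _ _ hLh hMh hL20 hLflat hLu B hB htol j hj θ
  exact h c hc hcle U hU hUle β hβmin hβc μ hμ Lh Mh hyp K hK L M hLh hMh hL20 hLflat hLu B
    (fun j => ctCr G * |U| * klScale klE0 j ^ 2 / klE0) hB (fun j _ => le_rfl) htol j hj θ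

/-- **The half-tolerance clause of `CtOneVolumeMsV11`** from conditional sup bounds of the partial sums (`T = tol/2`; `tol ≥ 0`). -/
theorem abs_klLocalPart_le_half_all_of_partialSums (G : GeoConsts) (P : SplitConsts) (Q : EngConsts) (hG : G.WF) (hQ : Q.WF) :
    ∃ c₃ : ℝ, 0 < c₃ ∧ ∃ U₀ : ℝ, 0 < U₀ ∧ ∃ ΛK : ℝ, 0 ≤ ΛK ∧ ∃ r₀ : ℝ, 0 < r₀ ∧
      ∀ c : ℝ, 0 < c → c ≤ c₃ → ∀ U : ℝ, 0 < U → U ≤ U₀ → ∀ β : ℝ, klBetaMin ≤ β → β ≤ Real.exp (c / U ^ 2) →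
      ∀ μ ∈ klWindowC, ∀ (Lh : ℕ) (Mh : ℕ → ℕ), CtHypMsV11 G P Q β U μ Lh Mh →
      ∀ K : TrigPolyC4v, FrameOK (ctRenMs G) U (nScales β) μ K →
      ∀ (L M : ℕ) [NeZero L] [NeZero M], Lh ≤ L → Mh L ≤ M → (20 : ℝ) ≤ L → 8 * π / klFlatR ≤ L → 2 * π / L < r₀ →
      ∀ B : ℕ → ℝ,
        (∀ j ≤ nScales β, (∀ i < j, RenormalisedAtF L M β U μ K (ctRenMs G) i) →
          ∀ q : Fin 2 → ℝ, |K.eval q + ∑ i ∈ range (j + 1), (klTwoLegPieceG L M β U μ K i).eval q| ≤ B j) →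
        (∀ j ≤ nScales β, B j + (4 / 3 * (G.S 1 + Q.S' 1 * |U|) * U ^ 2 * (2 * π / L) +
          (angBar G Q (ctRenMs G) U (nScales β) 1 + ΛK) * π * (2 * (π / L) / r₀)) ≤
            ctCr G * |U| * klScale klE0 j ^ 2 / klE0 / 2) →
        ∀ j ≤ nScales β, (∀ θ : ℝ, |klLocalPart L M β U μ K j θ| ≤ ctCr G * |U| * klScale klE0 j ^ 2 / klE0 / 2) ∧
          RenormalisedAtF L M β U μ K (ctRenMs G) j := by
  obtain ⟨c₃, hc₃, U₀, hU₀, ΛK, hΛK, r₀, hr₀, h⟩ := abs_klLocalPart_le_all_of_partialSums G P Q hG hQ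
  refine ⟨c₃, hc₃, U₀, hU₀, ΛK, hΛK, r₀, hr₀, ?_⟩
  intro c hc hcle U hU hUle β hβmin hβc μ hμ Lh Mh hyp K hK L M _ _ hLh hMh hL20 hLflat hLu B hB htol j hj
  have htolnn : ∀ j, 0 ≤ ctCr G * |U| * klScale klE0 j ^ 2 / klE0 := by
    intro j
    have hS : ∀ j, 0 ≤ G.S j := hG.2.2.2.2.2.2.2.2.2.2.2.2.2.2.2.2.2.1
    have hcr : 0 ≤ ctCr G := by unfold ctCr; nlinarith [hS 0]
    have he0 : (0 : ℝ) < klE0 := by norm_num [klE0]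
    positivity
  have hhalf := h c hc hcle U hU hUle β hβmin hβc μ hμ Lh Mh hyp K hK L M hLh hMh hL20 hLflat hLu B
    (fun j => ctCr G * |U| * klScale klE0 j ^ 2 / klE0 / 2) hB (fun j _ => by linarith [htolnn j]) htol j hj
  refine ⟨hhalf, fun θ => ?_⟩
  show |klLocalPart L M β U μ K j θ| ≤ ctCr G * |U| * klScale klE0 j ^ 2 / klE0
  linarith [hhalf θ, htolnn j]

end Summit.HubbardSuperconductivity.HubbardSuperconductivity.Theorems.KLRegimeSplit

end
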